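import Summits.QuantumFields.BalabanUV.Beta.GAN24.DirichletExhaustionDeltaZ
import Summits.QuantumFields.BalabanUV.Beta.GAN24.DirichletExhaustionWall

/-!
# `BalabanUV.Beta.GAN24.DirichletExhaustionDeltaZConv` — binder row G-an2-4 / (CONV-C), part P2, PART 19: THE EFFECTIVE-FORM CONSTITUENT
# `k ↦ Δ_k = deltaZ L k` ((1.66) on ℤ^{d+1}) ITSELF SATISFIES THE (CONV-C) SHAPE `ConvC` AND THE WALL'S `DecayCauchy`/`UniformDecays`/
# `SupRate` CURRENCIES, `θ = L⁻²`, CONSTANTS DISPLAYED IN `(d, L)` (unit b2b-balaban-gan24-p2, gen 3, v1)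

HONEST FRAMING (cell contract, verbatim): «discharging `BetaPertH` makes Bałaban's UV stability UNCONDITIONAL — a real constructive-QFT
result; it is NOT the continuum limit and NOT the Clay problem.»  This file is bookkeeping over PART 8 (`DirichletExhaustionDeltaZ`:
`deltaZ_abs_le` = k-uniform decay `c166Z(d)·e^{−κZ(d)|x−y|_∞}`, `deltaZ_step_abs_le` = one-step rate `θ166Z(d)·(L⁻²)^k·e^{−κZ(d)|x−y|_∞}`,
both from the t4-ne2 lineage's `ratePair_kerFamily2` BY NAME) and PART 6 (`DirichletExhaustionWall`: `ConvC` ⟹ `DecayCauchy` /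
`UniformDecays` / `SupRate`).  WHY IT IS FILED: PART 18 delivered (CONV-C) for the COVARIANCE constituent `C^{(k)}(𝟙) = C·(CᵀΔ_kC)⁻¹·Cᵀ`
(`convC_balaban`, `decayCauchy_balaban`); the EFFECTIVE-FORM constituent `Δ_k` — by [Balaban1984PropagatorsI] (1.65) p. 29 «The action Δ_k is
thus defined by ⟨B, Δ_kB⟩ = ⟨∂H_kB, ∂H_kB⟩» the quadratic form of the `k`-step effective action at `U = 1`, typed on ℤ^{d+1} as PART 8's kernel
`deltaZ L k` of the (1.66) symbol — is recorded here in the SAME two currencies with ONE displayed pair of constants, so that a consumer needing the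
decay / one-step rate of the effective form reads it by name.  WHAT IT DOES NOT DO: it asserts NO dictionary between `deltaZ` and any block of
the an2 lineage's packed resolvent `KInvStep` (node S6 of `HOME/b2b-balaban-gan24-p2/gen1/SKELETON-P2.md`, owned by an2 ∕ gan24-p1; cf. the
torus-side identifications an5 `Beta.BlockEffectiveAction.DelK`, b05 `B5Hk163Form166.DelK_form_eq_formDk`, pv09 `B6Cov2156Torus.represents_deltaPol`
and PART 12 `deltaPol_eq_tsum_deltaZ`, none of which is used or restated here); it is NOT the K-slot of row G-an2-4, NOT `BetaPertH`, NOT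
continuum, NOT Clay.  «not in print; our proof attempt» applies to nothing here: every statement is an elementary repackaging of tree theorems.

ABSOLUTE RULE (cell, verbatim): «No internally-minted statement may enter as a cited fact. Every hypothesis is either kernel-proved in this
package or a verbatim quotation of a PUBLISHED theorem with page reference. The manuscript(s) under audit are NOT citable for their own disputed
steps — they are the thing under adjudication; programme-internal (2001/route/tribunal) claims are never citable.»  No hypothesis of any
theorem below is a printed statement; no `Prop` is minted.

WHAT IS PROVED (0 sorry; no `def`): `c166Z_pos`, `convZ_pos` (the displayed constant `max{c166Z d, θ166Z d}` is positive),
**`convC_deltaZ`** (`ConvC (deltaZ L) (max{c166Z d, θ166Z d}) (kappaZ d) L⁻²`, every `L ≥ 1`), `uniformDecays_deltaZ`, `supRate_deltaZ`,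
**`decayCauchy_deltaZ`** (`L ≥ 2`: `DecayCauchy (k ↦ toMKer (deltaZ L k)) (max{c166Z d, θ166Z d}/(1−L⁻²)) L⁻² (kappaZ d/(d+1))`),
`decayCauchy_deltaZ'` (∃-packaged, same shape as PART 18's `decayCauchy_balaban`).  NOT summit progress.
-/

namespace Summit.QuantumFields.BalabanUV.Beta.GAN24.DirichletExhaustionDeltaZConv

open Literature.MathematicalPhysics.QuantumFieldTheory.Balaban1983to89
open B5Symbol166Strip (MG_pos)
open B4Sect5Exhaustion (K)
open Summit.QuantumFields.BalabanUV.Beta.GAN24.DirichletExhaustion (ConvC)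
open Summit.QuantumFields.BalabanUV.Beta.GAN24.DirichletExhaustionDeltaZ
open Summit.QuantumFields.BalabanUV.Beta.GAN24.DirichletExhaustionDecays (toMKer)
open Summit.QuantumFields.BalabanUV.Beta.GAN24.DirichletExhaustionWall (decayCauchy_of_convC uniformDecays_of_convC supRate_of_convC)
open Summit.QuantumFields.BalabanUV.Beta.GAN24.CombesThomas (DecayCauchy UniformDecays SupRate)

noncomputable section

variable {d : ℕ}

/-! ## §1 The displayed constant `max{c166Z d, θ166Z d}` -/

/-- `c166Z d > 0` (PART 8's decay constant `4(d+1)²·MG(d+1)`). -/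
theorem c166Z_pos (d : ℕ) : 0 < c166Z d := by
  unfold c166Z; have := MG_pos (d + 1); positivity

/-- THE (CONV-C) CONSTANT OF THE `Δ_k` FAMILY, `max{c166Z d, θ166Z d} = 4(d+1)²·max{MG(d+1), 8·C166(d+1)}`, is positive — one displayed
constant serving both the decay clause (PART 8 `c166Z`) and the one-step clause (PART 8 `theta166Z`). -/
theorem convZ_pos (d : ℕ) : 0 < max (c166Z d) (theta166Z d) := lt_max_of_lt_left (c166Z_pos d)

/-! ## §2 (CONV-C) for the effective-form constituent `Δ_k` -/

/-- **(CONV-C) FOR `k ↦ Δ_k = deltaZ L k`** (every `L ≥ 1`, every `d`): k-uniform decay `|Δ_k(b,b′)| ≤ max{c166Z, θ166Z}(d)·e^{−κZ(d)|b₋−b′₋|_∞}` AND the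
one-step rate `|Δ_{k+1}(b,b′) − Δ_k(b,b′)| ≤ max{c166Z, θ166Z}(d)·(L⁻²)^k·e^{−κZ(d)|b₋−b′₋|_∞}` — PART 8's `deltaZ_abs_le` / `deltaZ_step_abs_le` with the two
constants merged into `max{c166Z d, θ166Z d}`. -/
theorem convC_deltaZ (L : ℕ) [NeZero L] :
    ConvC (deltaZ (d := d) L) (max (c166Z d) (theta166Z d)) (kappaZ d) (((L : ℝ) ^ 2)⁻¹) := by
  refine ⟨fun k p q => ?_, fun k p q => ?_⟩
  · exact (deltaZ_abs_le L k p q).trans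
      (mul_le_mul_of_nonneg_right (le_max_left _ _) (Real.exp_nonneg _))
  · refine (deltaZ_step_abs_le L k p q).trans ?_
    have hθ : (0 : ℝ) ≤ (((L : ℝ) ^ 2)⁻¹) ^ k := by positivity
    have := mul_le_mul_of_nonneg_right (le_max_right (c166Z d) (theta166Z d)) (mul_nonneg hθ (Real.exp_nonneg (-(kappaZ d * dist p.1 q.1))))
    simpa only [mul_assoc] using this

/-- (hK)-currency: `UniformDecays (k ↦ toMKer (deltaZ L k)) (max (c166Z d) (theta166Z d)) (kappaZ d/(d+1))` (ℓ¹ rate; PART 6 `uniformDecays_of_convC`). -/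
theorem uniformDecays_deltaZ (L : ℕ) [NeZero L] :
    UniformDecays (fun k => toMKer (deltaZ (d := d) L k)) (max (c166Z d) (theta166Z d)) (kappaZ d / ((d + 1 : ℕ) : ℝ)) :=
  uniformDecays_of_convC (convZ_pos d).le (kappaZ_pos d).le (convC_deltaZ L)

/-- SUP-norm one-step rate: `SupRate (k ↦ toMKer (deltaZ L k)) (max (c166Z d) (theta166Z d)) L⁻²` (PART 6 `supRate_of_convC`). -/
theorem supRate_deltaZ (L : ℕ) [NeZero L] :
    SupRate (fun k => toMKer (deltaZ (d := d) L k)) (max (c166Z d) (theta166Z d)) (((L : ℝ) ^ 2)⁻¹) :=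
  supRate_of_convC (convZ_pos d).le (kappaZ_pos d).le (by positivity) (convC_deltaZ L)

/-- **(hKall)-currency FOR `Δ_k`** (`L ≥ 2`, so `θ = L⁻² < 1`): `DecayCauchy (k ↦ toMKer (deltaZ L k)) (max{c166Z d, θ166Z d}/(1−L⁻²)) L⁻² (kappaZ d/(d+1))` —
PART 6 `decayCauchy_of_convC` (road P1's telescoping, no `(√θ, δ/2)` loss) applied to `convC_deltaZ`. -/
theorem decayCauchy_deltaZ (L : ℕ) [NeZero L] (hL : 2 ≤ L) :
    DecayCauchy (fun k => toMKer (deltaZ (d := d) L k)) (max (c166Z d) (theta166Z d) / (1 - ((L : ℝ) ^ 2)⁻¹)) (((L : ℝ) ^ 2)⁻¹)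
      (kappaZ d / ((d + 1 : ℕ) : ℝ)) := by
  have hθ0 : (0 : ℝ) ≤ ((L : ℝ) ^ 2)⁻¹ := by positivity
  have hθ1 : ((L : ℝ) ^ 2)⁻¹ < 1 := by
    have hL' : (2 : ℝ) ≤ L := by exact_mod_cast hL
    have : (1 : ℝ) < (L : ℝ) ^ 2 := by nlinarith
    exact inv_lt_one_of_one_lt₀ this
  exact decayCauchy_of_convC (convZ_pos d).le (kappaZ_pos d).le hθ0 hθ1 (convC_deltaZ L)

/-- The same, ∃-packaged in the shape of PART 18's `decayCauchy_balaban` (explicit witnesses `C₄ = max{c166Z d, θ166Z d}`, `δ₄ = kappaZ d`). -/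
theorem decayCauchy_deltaZ' (L : ℕ) [NeZero L] (hL : 2 ≤ L) :
    ∃ C₄ δ₄ : ℝ, 0 ≤ C₄ ∧ 0 < δ₄ ∧
      ConvC (deltaZ (d := d) L) C₄ δ₄ (((L : ℝ) ^ 2)⁻¹) ∧
      DecayCauchy (fun k => toMKer (deltaZ (d := d) L k)) (C₄ / (1 - ((L : ℝ) ^ 2)⁻¹)) (((L : ℝ) ^ 2)⁻¹)
        (δ₄ / ((d + 1 : ℕ) : ℝ)) :=
  ⟨max (c166Z d) (theta166Z d), kappaZ d, (convZ_pos d).le, kappaZ_pos d, convC_deltaZ L, decayCauchy_deltaZ L hL⟩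

end

end Summit.QuantumFields.BalabanUV.Beta.GAN24.DirichletExhaustionDeltaZConv
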